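/- Width seat `ym-line-sfw-p2-w5` (prover-ym-line-sfw-p2-w5-g18-0), free hands on planner ym-idea-2 g16's LINE-19 task board (STUB-PLAN-S4b §10,
toward the FREE item T5 = the S4b assembly; crux `AllWindowsColdBox.BoxHighWindowsSU22` = stmt-QuantumFields-24004 / 24335, stub S4b):
fourth brick — Stage I with the TOTAL defect, and the quadratic BCH error summed over the Hodge system (Cauchy–Schwarz against the total defect). -/
import Summits.QuantumFields.YangMills.Theorems.AllWindowsColdBoxBoxHighLineBootstrapCirculationBound

/-!
# LINE-19 S4b §10, fourth brick of T5: the total Stage-I defect and the summed BCH error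

* `exists_landau_total` : Stage I exporting the TOTAL functional — an interior `g` with `U^g` in lattice Landau gauge and
  `Σ_{e ∈ cold box} linkDefect (U^g) e ≤ 72900·H⁸·s²` (hence every single link too);
* `linkDefect_gaugeTransform_eq_zero_of_not_mem_boxEdges` : off the cold box the defect of `U^g` vanishes;
* `sq_linkSum_le` : for four links, `(Σ_{k<4}Σ_{c'} |imVec(W_k)_{c'}|)² ≤ 12·Σ_k linkDefect(W_k)` (Cauchy–Schwarz + ✓`sum_imVec_sq_le_linkDefect`);
* `sum_slot_le` : for `f ≥ 0` vanishing off the cold box and an injective slot map, `Σ_{p ∈ hodgePlaqs} f(slot p) ≤ 4·Σ_{e ∈ box} f e`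
  (`slot_injective`: the four edge slots of a plaquette label), hence `sum_plaquette_links_le` : `Σ_p Σ_k f(edge_k p) ≤ 16·Σ_{e∈box} f e`;
* **`sq_sum_abs_mul_linkSum_le`** : `(Σ_p |G_p|·n_p)² ≤ (Σ_p G_p²)·(192·Σ_{e∈box} linkDefect (U^g) e)`
  (Cauchy–Schwarz ✓`Finset.sum_mul_sq_le_sq_mul_sq`), with `n_p = Σ_kΣ_{c'}|imVec(W(edge_k p))_{c'}|`.

Everything proved; no definition; standard axioms.  HONEST LABEL: helpers toward ONE registered stub (S4b) of a critic-PASSed line on the R2ξ″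
RECORD-rung crux 24004 / 24335; no stub is proved by name, no crux, rung or summit is proved; the Yang–Mills mass gap is NOT proved by this file.
-/

set_option autoImplicit false

noncomputable section

open Finset Matrix
open Literature.MathematicalPhysics.QuantumFieldTheory hiding boxEdges
open Literature.MathematicalPhysics.QuantumFieldTheory.LatticeMaxwell
open Literature.MathematicalPhysics.QuantumFieldTheory.AxialGauge
open Summit.QuantumFields.YangMills.Theorems.WeakCouplingRates
open Literature.Probability.LatticeModels (Site)
open Literature.MathematicalPhysics.QuantumLattice (LGConfig gaugeTransformZd plaquetteHolonomyZd fundamentalRep)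

namespace Summit.QuantumFields.YangMills.Theorems.AllWindowsColdBoxBoxHighLine

/-! ## Stage I with the total defect -/

/-- **Stage I, total form**: an interior gauge transform putting `U` in lattice Landau gauge with TOTAL cold-box defect `≤ 72900·H⁸·s²`. -/
theorem exists_landau_total {H : ℕ} (hH : 1 ≤ H) {s : ℝ} (hs : 0 ≤ s) {U : LGConfig 4 SU2}
    (hW : ColdWall H U) (hS : SmallPlaquettes H s U) :
    ∃ g : Site 4 → SU2, IsInteriorGauge H g ∧ InLandauGauge H (gaugeTransformZd g U) ∧
      (∑ e ∈ boxEdges 4 (2 * H + 1), linkDefect (gaugeTransformZd g U) e ≤ 72900 * (H : ℝ) ^ 8 * s ^ 2) ∧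
      ∀ e ∈ boxEdges 4 (2 * H + 1), linkDefect (gaugeTransformZd g U) e ≤ 72900 * (H : ℝ) ^ 8 * s ^ 2 := by
  obtain ⟨g, hg, hL, hmin⟩ := exists_interior_landauGauge_min H U
  have htot : ∑ e ∈ boxEdges 4 (2 * H + 1), linkDefect (gaugeTransformZd g U) e ≤ 72900 * (H : ℝ) ^ 8 * s ^ 2 :=
    (hmin _ (forestGauge_isInteriorGauge H U)).trans (landauFunctional_forestGauge_le hH hs hW hS)
  refine ⟨g, hg, hL, htot, fun e he => ?_⟩
  exact (Finset.single_le_sum (f := fun e => linkDefect (gaugeTransformZd g U) e) (fun e _ => linkDefect_nonneg _ e) he).trans htot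

/-- Off the cold box the defect of `U^g` vanishes (cold wall, interior gauge). -/
theorem linkDefect_gaugeTransform_eq_zero_of_not_mem_boxEdges {H : ℕ} {U : LGConfig 4 SU2} (hU : ColdWall H U)
    {g : Site 4 → SU2} (hg : IsInteriorGauge H g) {E : Literature.MathematicalPhysics.QuantumLattice.ZdEdge 4}
    (hE : E ∉ boxEdges 4 (2 * H + 1)) : linkDefect (gaugeTransformZd g U) E = 0 := by
  rw [linkDefect_eq, gaugeTransformZd_eq_one_of_not_mem_boxEdges hU hg hE]
  show (2 : ℝ) - ((1 : Matrix (Fin 2) (Fin 2) ℂ).trace).re = 0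
  rw [Matrix.trace_one]
  norm_num

/-! ## The size of four links against their defects -/

/-- `(Σ_{k<4}Σ_{c'} |imVec(W_k)_{c'}|)² ≤ 12·Σ_k (2 − Re tr W_k)`. -/
theorem sq_linkSum_le (W : Fin 4 → SU2) :
    (∑ k : Fin 4, ∑ c' : Fin 3, |imVec (W k) c'|) ^ 2 ≤
      12 * ∑ k : Fin 4, (2 - ((W k : Matrix (Fin 2) (Fin 2) ℂ).trace).re) := by
  -- Cauchy–Schwarz on the 12 terms, then `Σ_{c'} imVec² ≤ cost`
  have hcs : (∑ q : Fin 4 × Fin 3, |imVec (W q.1) q.2| * 1) ^ 2 ≤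
      (∑ q : Fin 4 × Fin 3, |imVec (W q.1) q.2| ^ 2) * ∑ q : Fin 4 × Fin 3, (1 : ℝ) ^ 2 :=
    Finset.sum_mul_sq_le_sq_mul_sq _ _ _
  have h12 : ∑ q : Fin 4 × Fin 3, (1 : ℝ) ^ 2 = 12 := by simp
  rw [h12] at hcs
  simp only [mul_one] at hcs
  have hflat : ∑ k : Fin 4, ∑ c' : Fin 3, |imVec (W k) c'| = ∑ q : Fin 4 × Fin 3, |imVec (W q.1) q.2| := by
    rw [← Finset.sum_product']; rfl
  have hflat2 : ∑ q : Fin 4 × Fin 3, |imVec (W q.1) q.2| ^ 2 = ∑ k : Fin 4, ∑ c' : Fin 3, imVec (W k) c' ^ 2 := by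
    rw [← Finset.sum_product']
    exact Finset.sum_congr rfl fun q _ => sq_abs _
  rw [hflat]
  refine hcs.trans ?_
  rw [hflat2, mul_comm]
  refine mul_le_mul_of_nonneg_left ?_ (by norm_num)
  exact Finset.sum_le_sum fun k _ => imVecSqLeCost (W k)

/-! ## Sums over the edge slots of the Hodge-system plaquettes -/

/-- The four slot maps of a plaquette label are injective. -/
theorem slot_injective :
    Function.Injective (fun p : Plaq 4 => (((p.1, p.2.1) : Literature.MathematicalPhysics.QuantumLattice.ZdEdge 4), p.2.2)) ∧
    Function.Injective (fun p : Plaq 4 => (((p.1 + Pi.single p.2.1 1, p.2.2) : Literature.MathematicalPhysics.QuantumLattice.ZdEdge 4), p.2.1)) ∧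
    Function.Injective (fun p : Plaq 4 => (((p.1 + Pi.single p.2.2 1, p.2.1) : Literature.MathematicalPhysics.QuantumLattice.ZdEdge 4), p.2.2)) ∧
    Function.Injective (fun p : Plaq 4 => (((p.1, p.2.2) : Literature.MathematicalPhysics.QuantumLattice.ZdEdge 4), p.2.1)) := by
  refine ⟨?_, ?_, ?_, ?_⟩
  · intro p q h
    simp only [Prod.mk.injEq] at h
    exact Prod.ext h.1.1 (Prod.ext h.1.2 h.2)
  · intro p q h
    simp only [Prod.mk.injEq] at h
    obtain ⟨⟨h1, h2⟩, h3⟩ := h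
    have hb : p.1 = q.1 := by
      have := congrArg (fun y => y - Pi.single p.2.1 (1 : ℤ)) h1
      simpa [h3] using this
    exact Prod.ext hb (Prod.ext h3 h2)
  · intro p q h
    simp only [Prod.mk.injEq] at h
    obtain ⟨⟨h1, h2⟩, h3⟩ := h
    have hb : p.1 = q.1 := by
      have := congrArg (fun y => y - Pi.single p.2.2 (1 : ℤ)) h1
      simpa [h3] using this
    exact Prod.ext hb (Prod.ext h2 h3)
  · intro p q h
    simp only [Prod.mk.injEq] at h
    exact Prod.ext h.1.1 (Prod.ext h.2 h.1.2)

/-- One slot: for an injective `φ : Plaq 4 → ZdEdge × Fin 4` and `f ≥ 0` vanishing off the cold box, `Σ_{p ∈ hodgePlaqs} f (φ p).1 ≤ 4·Σ_{e∈box} f e`. -/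
theorem sum_slot_le {H : ℕ} (f : Literature.MathematicalPhysics.QuantumLattice.ZdEdge 4 → ℝ) (hf0 : ∀ E, 0 ≤ f E)
    (hfz : ∀ E, E ∉ boxEdges 4 (2 * H + 1) → f E = 0)
    (φ : Plaq 4 → Literature.MathematicalPhysics.QuantumLattice.ZdEdge 4 × Fin 4) (hφ : Function.Injective φ) :
    ∑ p ∈ hodgePlaqs H, f (φ p).1 ≤ 4 * ∑ e ∈ boxEdges 4 (2 * H + 1), f e := by
  classical
  rw [← Finset.sum_image (f := fun q : Literature.MathematicalPhysics.QuantumLattice.ZdEdge 4 × Fin 4 => f q.1)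
    (fun p _ q _ h => hφ h)]
  calc ∑ q ∈ (hodgePlaqs H).image φ, f q.1
      = ∑ q ∈ ((hodgePlaqs H).image φ).filter (fun q => q.1 ∈ boxEdges 4 (2 * H + 1)), f q.1 := by
        rw [Finset.sum_filter]
        refine Finset.sum_congr rfl fun q _ => ?_
        split_ifs with h
        · rfl
        · exact hfz q.1 h
    _ ≤ ∑ q ∈ boxEdges 4 (2 * H + 1) ×ˢ (Finset.univ : Finset (Fin 4)), f q.1 :=
        Finset.sum_le_sum_of_subset_of_nonneg
          (fun q hq => Finset.mem_product.2 ⟨(Finset.mem_filter.1 hq).2, Finset.mem_univ _⟩) fun q _ _ => hf0 q.1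
    _ = 4 * ∑ e ∈ boxEdges 4 (2 * H + 1), f e := by
        rw [Finset.sum_product, Finset.mul_sum]
        refine Finset.sum_congr rfl fun e _ => ?_
        simp [Finset.sum_const, Finset.card_univ, Fintype.card_fin]

/-- **All four slots**: `Σ_{p ∈ hodgePlaqs} Σ_{k<4} f(edge_k p) ≤ 16·Σ_{e∈box} f e` for `f ≥ 0` vanishing off the cold box. -/
theorem sum_plaquette_links_le {H : ℕ} (f : Literature.MathematicalPhysics.QuantumLattice.ZdEdge 4 → ℝ) (hf0 : ∀ E, 0 ≤ f E)
    (hfz : ∀ E, E ∉ boxEdges 4 (2 * H + 1) → f E = 0) :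
    ∑ p ∈ hodgePlaqs H, (f (p.1, p.2.1) + f (p.1 + Pi.single p.2.1 1, p.2.2) + f (p.1 + Pi.single p.2.2 1, p.2.1) + f (p.1, p.2.2)) ≤
      16 * ∑ e ∈ boxEdges 4 (2 * H + 1), f e := by
  obtain ⟨i0, i1, i2, i3⟩ := slot_injective
  have h0 := sum_slot_le f hf0 hfz _ i0
  have h1 := sum_slot_le f hf0 hfz _ i1
  have h2 := sum_slot_le f hf0 hfz _ i2
  have h3 := sum_slot_le f hf0 hfz _ i3
  simp only [] at h0 h1 h2 h3
  rw [Finset.sum_add_distrib, Finset.sum_add_distrib, Finset.sum_add_distrib]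
  linarith

/-! ## The summed BCH error by Cauchy–Schwarz -/

/-- **Cauchy–Schwarz for the summed error**: with `n_p = Σ_kΣ_{c'}|imVec(W(edge_k p))_{c'}|` for `W = U^g` (cold wall, interior gauge),
`(Σ_p |G_p|·n_p)² ≤ (Σ_p G_p²)·(192·Σ_{e∈box} linkDefect (U^g) e)`. -/
theorem sq_sum_abs_mul_linkSum_le {H : ℕ} {U : LGConfig 4 SU2} (hU : ColdWall H U) {g : Site 4 → SU2}
    (hg : IsInteriorGauge H g) (G : Plaq 4 → ℝ) :
    (∑ p ∈ hodgePlaqs H, |G p| * ∑ k : Fin 4, ∑ c' : Fin 3,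
        |imVec ((![gaugeTransformZd g U (p.1, p.2.1), gaugeTransformZd g U (p.1 + Pi.single p.2.1 1, p.2.2),
          gaugeTransformZd g U (p.1 + Pi.single p.2.2 1, p.2.1), gaugeTransformZd g U (p.1, p.2.2)] : Fin 4 → SU2) k) c'|) ^ 2 ≤
      (∑ p ∈ hodgePlaqs H, G p ^ 2) * (192 * ∑ e ∈ boxEdges 4 (2 * H + 1), linkDefect (gaugeTransformZd g U) e) := by
  refine (Finset.sum_mul_sq_le_sq_mul_sq _ _ _).trans ?_
  have hG : ∑ p ∈ hodgePlaqs H, |G p| ^ 2 = ∑ p ∈ hodgePlaqs H, G p ^ 2 := Finset.sum_congr rfl fun p _ => sq_abs _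
  rw [hG]
  refine mul_le_mul_of_nonneg_left ?_ (Finset.sum_nonneg fun _ _ => sq_nonneg _)
  -- `Σ_p n_p² ≤ 12 Σ_p Σ_k defect(edge_k p) ≤ 12·16 Σ_e defect`
  have hsq : ∀ p ∈ hodgePlaqs H, (∑ k : Fin 4, ∑ c' : Fin 3,
      |imVec ((![gaugeTransformZd g U (p.1, p.2.1), gaugeTransformZd g U (p.1 + Pi.single p.2.1 1, p.2.2),
        gaugeTransformZd g U (p.1 + Pi.single p.2.2 1, p.2.1), gaugeTransformZd g U (p.1, p.2.2)] : Fin 4 → SU2) k) c'|) ^ 2 ≤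
      12 * (linkDefect (gaugeTransformZd g U) (p.1, p.2.1) + linkDefect (gaugeTransformZd g U) (p.1 + Pi.single p.2.1 1, p.2.2) +
        linkDefect (gaugeTransformZd g U) (p.1 + Pi.single p.2.2 1, p.2.1) + linkDefect (gaugeTransformZd g U) (p.1, p.2.2)) := by
    intro p _
    refine (sq_linkSum_le _).trans (le_of_eq ?_)
    simp only [Fin.sum_univ_four, Matrix.cons_val_zero, Matrix.cons_val_one, Matrix.cons_val_two, Matrix.cons_val_three,
      Matrix.head_cons, Matrix.tail_cons, linkDefect_eq]
  refine (Finset.sum_le_sum hsq).trans ?_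
  rw [← Finset.mul_sum]
  have h16 := sum_plaquette_links_le (H := H) (fun E => linkDefect (gaugeTransformZd g U) E) (fun E => linkDefect_nonneg _ E)
    (fun E hE => linkDefect_gaugeTransform_eq_zero_of_not_mem_boxEdges hU hg hE)
  linarith

end Summit.QuantumFields.YangMills.Theorems.AllWindowsColdBoxBoxHighLine

end
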